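import Summits.NavierStokesRegularity.NavierStokesRegularity.Theses.LerayQuarterDissipation
import Summits.NavierStokesRegularity.NavierStokesRegularity.Theorems.LerayQuarterDissipationRecurrentReductionDRecurrentUnif
import Summits.NavierStokesRegularity.NavierStokesRegularity.Theorems.LerayQuarterDissipationRecurrentReductionDER
import HarnessLib

/-!
# Route `LerayQuarterDissipation`, item `RecurrentReductionD` (stmt-NavierStokesRegularity-22507):
# Birkhoff reduction for the finite-dissipation class `𝒟` — the deciding theorem

`RecurrentReductionD`: every Type-I mild ancient solution `ū` with Leray's quarter dissipation
law `∫|∇ū(s)|² ≤ K/√(−s)` which is singular at the space-time origin has, in the closure of its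
scaling orbit, a profile `w` in the same class (same `C`, same `K`) which is UNIFORMLY RECURRENT
under the scaling flow and still singular at the origin.

Proof (`recurrentReductionD_proof`). By `exists_recurrent_of_persistent_unif` (Birkhoff
recurrence on the compact scaling hull + closedness of `𝒟`) it suffices to show PERSISTENCE of
the apex singularity along uniform-on-pieces limits `W` of rescalings `ū_{l_k}`
(`persistent_singularity`). If `W` were bounded near the origin, a further zoom `μ` makes the
slice `ū_{l_k μ}(t₁, ·)` uniformly small on `B(0, A)` for one `k` (uniform convergence on a slab
piece), and the pressure-free sup-norm ε-regularity of the class (`epsilon_regularity`: Stage 1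
Type-I smallness on a parabolic region by a first-bad-time argument on the Oseen/Duhamel formula,
Stage 2 boundedness by a ring induction using the `L⁶` slices supplied by the dissipation law)
bounds `ū_{l_k μ}` near the origin — contradicting the scale invariance of the apex singularity
(`singularAtOrigin_nsRescale`).

NS regularity is NOT proved here: this closes the support item `RecurrentReductionD` of the
thesis `FiniteDissipationLiouville` only.

References: G. Koch, N. Nadirashvili, G. Seregin, V. Šverák, Acta Math. 203 (2009),
arXiv:0709.3599 [KochNadirashviliSereginSverak2009]; J. Leray, Acta Math. 63 (1934) [Leray1934].
-/

noncomputable section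

-- the summit and its single problem share the name (D-0017 nested layout)
set_option linter.dupNamespace false

namespace Summit.NavierStokesRegularity.NavierStokesRegularity.Theorems

open MeasureTheory Set Function Filter Topology Metric
open Literature.Analysis Literature.Analysis.FluidPDE Literature.Analysis.UnboundedOperators
open scoped ENNReal NNReal

namespace RecurrentReductionD

/-- **Persistence of the apex singularity in `𝒟`**: if `ū ∈ 𝒟_{C,K}` is singular at the origin,
`l_k > 0`, and the rescalings `ū_{l_k}` converge uniformly on every slab piece
`[−(n+2), −1/(n+2)] × B̄(0, n+2)` to a Type-I ancient mild field `W`, then `W` is singular at the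
origin (module docstring: zoom, uniform smallness of one slice, ε-regularity, scale invariance of
the singularity). [cite: KochNadirashviliSereginSverak2009, §4 (arXiv:0709.3599 p. 8)] -/
theorem persistent_singularity {C K : ℝ}
    {u : ℝ → EuclideanSpace ℝ (Fin 3) → EuclideanSpace ℝ (Fin 3)}
    (hu : IsTypeIAncientMild C u)
    (hlaw : ∀ s : ℝ, s < 0 → ∫⁻ x, ‖fderiv ℝ (u s) x‖ₑ ^ 2 ≤ ENNReal.ofReal (K / Real.sqrt (-s)))
    (hsing : ∀ r > 0, ∀ M : ℝ, ∃ t ∈ Ioo (-(r ^ 2)) (0 : ℝ),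
      ∃ x ∈ ball (0 : EuclideanSpace ℝ (Fin 3)) r, M < ‖u t x‖)
    (l : ℕ → ℝ) (hl : ∀ k, 0 < l k)
    (W : ℝ → EuclideanSpace ℝ (Fin 3) → EuclideanSpace ℝ (Fin 3))
    (hunif : ∀ n : ℕ, TendstoUniformlyOn (fun k z => nsRescale (l k) u z.1 z.2) (fun z => W z.1 z.2)
      atTop (Icc (-((n : ℝ) + 2)) (-(1 / ((n : ℝ) + 2))) ×ˢ
        closedBall (0 : EuclideanSpace ℝ (Fin 3)) ((n : ℝ) + 2))) :
    ∀ r > 0, ∀ M : ℝ, ∃ t ∈ Ioo (-(r ^ 2)) (0 : ℝ),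
      ∃ x ∈ ball (0 : EuclideanSpace ℝ (Fin 3)) r, M < ‖W t x‖ := by
  -- the `L⁶` constant of the class and the ε-regularity scales
  obtain ⟨CS, hCS⟩ := eLpNorm_six_le_of_dissipationLaw
  set k₆ : ℝ := (CS : ℝ) * Real.sqrt (max K 0) with hk₆
  have hk₆0 : 0 ≤ k₆ := by rw [hk₆]; positivity
  obtain ⟨t₁, ht₁, A, hA, ε₀, hε₀, hER⟩ := epsilon_regularity (k₆ := k₆) hu.nonneg hk₆0
  set s : ℝ := -t₁ with hs
  have hspos : 0 < s := by rw [hs]; exact neg_pos.2 ht₁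
  intro r hr Mb
  by_contra hcon
  push Not at hcon
  -- `W` is bounded by `Mb' > 0` on `(−r², 0) × B(0, r)`
  set Mb' : ℝ := max Mb 1 with hMb'
  have hMb'pos : 0 < Mb' := lt_of_lt_of_le one_pos (le_max_right _ _)
  have hWb : ∀ t ∈ Ioo (-(r ^ 2)) (0 : ℝ), ∀ x ∈ ball (0 : EuclideanSpace ℝ (Fin 3)) r,
      ‖W t x‖ ≤ Mb' := fun t ht x hx => (hcon t ht x hx).trans (le_max_left _ _)
  -- ## the zoom factor `μ`
  set B : ℝ := Mb' + A + Real.sqrt s + 1 with hB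
  have hBpos : 0 < B := by rw [hB]; positivity
  set m : ℝ := min (min ε₀ r) 1 with hm
  have hmpos : 0 < m := by rw [hm]; exact lt_min (lt_min hε₀ hr) one_pos
  have hmε : m ≤ ε₀ := (min_le_left _ _).trans (min_le_left _ _)
  have hmr : m ≤ r := (min_le_left _ _).trans (min_le_right _ _)
  have hm1 : m ≤ 1 := min_le_right _ _
  set μ : ℝ := m / (2 * B) with hμ
  have hμpos : 0 < μ := by rw [hμ]; positivity
  have hBne : B ≠ 0 := hBpos.ne'
  have hμB : μ * B = m / 2 := by rw [hμ]; field_simp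
  have hμMb : μ * Mb' ≤ ε₀ / 2 := by
    have : μ * Mb' ≤ μ * B := mul_le_mul_of_nonneg_left (by rw [hB]; have := Real.sqrt_nonneg s; linarith) hμpos.le
    linarith
  have hμA : μ * A < r ∧ μ * A ≤ 1 / 2 := by
    have : μ * A ≤ μ * B - μ := by
      rw [← mul_sub_one]; refine mul_le_mul_of_nonneg_left ?_ hμpos.le
      rw [hB]; have := Real.sqrt_nonneg s; linarith
    constructor <;> linarith
  have hμs : μ * Real.sqrt s < r ∧ μ * Real.sqrt s ≤ 1 / 2 := by
    have : μ * Real.sqrt s ≤ μ * B - μ := by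
      rw [← mul_sub_one]; refine mul_le_mul_of_nonneg_left ?_ hμpos.le
      rw [hB]; linarith
    constructor <;> linarith
  have hμ2s : μ ^ 2 * s < r ^ 2 ∧ μ ^ 2 * s ≤ 1 := by
    have e : μ ^ 2 * s = (μ * Real.sqrt s) ^ 2 := by
      rw [mul_pow, Real.sq_sqrt hspos.le]
    have h0 : 0 ≤ μ * Real.sqrt s := by positivity
    rw [e]
    constructor
    · exact pow_lt_pow_left₀ hμs.1 h0 two_ne_zero
    · have h1 := mul_le_mul hμs.2 hμs.2 h0 (by norm_num)
      rw [sq]; linarith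
  -- ## the slab piece containing the zoomed data region
  set n : ℕ := max (Nat.ceil (1 / (μ ^ 2 * s))) (Nat.ceil r) with hn
  have hn1 : 1 / (μ ^ 2 * s) ≤ (n : ℝ) + 2 := by
    have : (Nat.ceil (1 / (μ ^ 2 * s)) : ℝ) ≤ n := by rw [hn]; exact_mod_cast le_max_left _ _
    have := Nat.le_ceil (1 / (μ ^ 2 * s)); linarith
  have hn2 : r ≤ (n : ℝ) + 2 := by
    have : (Nat.ceil r : ℝ) ≤ n := by rw [hn]; exact_mod_cast le_max_right _ _
    have := Nat.le_ceil r; linarith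
  have hμ2spos : 0 < μ ^ 2 * s := by positivity
  have hpiece : ∀ y : EuclideanSpace ℝ (Fin 3), ‖y‖ ≤ A →
      ((μ ^ 2 * t₁, μ • y) : ℝ × EuclideanSpace ℝ (Fin 3)) ∈
        Icc (-((n : ℝ) + 2)) (-(1 / ((n : ℝ) + 2))) ×ˢ closedBall (0 : EuclideanSpace ℝ (Fin 3)) ((n : ℝ) + 2) := by
    intro y hy
    refine ⟨⟨?_, ?_⟩, ?_⟩
    · have : μ ^ 2 * t₁ = -(μ ^ 2 * s) := by rw [hs]; ring
      rw [this]; have : (1 : ℝ) ≤ (n : ℝ) + 2 := by have := n.cast_nonneg (α := ℝ); linarith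
      linarith [hμ2s.2]
    · have : μ ^ 2 * t₁ = -(μ ^ 2 * s) := by rw [hs]; ring
      rw [this, neg_le_neg_iff, div_le_iff₀ (by positivity : (0 : ℝ) < (n : ℝ) + 2)]
      rw [div_le_iff₀ hμ2spos] at hn1
      linarith
    · rw [mem_closedBall_zero_iff, norm_smul, Real.norm_of_nonneg hμpos.le]
      have : μ * ‖y‖ ≤ μ * A := mul_le_mul_of_nonneg_left hy hμpos.le
      linarith [hμA.1]
  -- ## one rescaling whose slice is uniformly close to `W` on the piece
  have hδ : 0 < ε₀ / (2 * μ) := by positivity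
  obtain ⟨k, hk⟩ := ((Metric.tendstoUniformlyOn_iff.1 (hunif n)) (ε₀ / (2 * μ)) hδ).exists
  -- ## the zoomed rescaling `v = ū_{l_k μ}` and its small slice
  set v : ℝ → EuclideanSpace ℝ (Fin 3) → EuclideanSpace ℝ (Fin 3) := nsRescale (l k * μ) u with hv_def
  have hc : 0 < l k * μ := mul_pos (hl k) hμpos
  have hv : IsTypeIAncientMild C v := isTypeIAncientMild_nsRescale hu hc
  have hvlaw := dissipationLaw_nsRescale hlaw hc
  have hvL6 : ∀ τ : ℝ, τ < 0 → eLpNorm (v τ) 6 volume ≤ ENNReal.ofReal (k₆ * (-τ) ^ (-(1 / 4 : ℝ))) :=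
    fun τ hτ => hCS C K v hv hvlaw τ hτ
  have hvdata : ∀ y : EuclideanSpace ℝ (Fin 3), ‖y‖ ≤ A → ‖v t₁ y‖ ≤ ε₀ := by
    intro y hy
    have e : v t₁ y = μ • nsRescale (l k) u (μ ^ 2 * t₁) (μ • y) := by
      rw [hv_def, nsRescale_mul, nsRescale_apply]
    rw [e, norm_smul, Real.norm_of_nonneg hμpos.le]
    have hz := hk (μ ^ 2 * t₁, μ • y) (hpiece y hy)
    dsimp only at hz
    rw [dist_eq_norm] at hz
    have hzt : μ ^ 2 * t₁ ∈ Ioo (-(r ^ 2)) (0 : ℝ) := by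
      have : μ ^ 2 * t₁ = -(μ ^ 2 * s) := by rw [hs]; ring
      rw [this]; exact ⟨by linarith [hμ2s.1], by linarith⟩
    have hzx : μ • y ∈ ball (0 : EuclideanSpace ℝ (Fin 3)) r := by
      rw [mem_ball_zero_iff, norm_smul, Real.norm_of_nonneg hμpos.le]
      have : μ * ‖y‖ ≤ μ * A := mul_le_mul_of_nonneg_left hy hμpos.le
      linarith [hμA.1]
    have hWz := hWb _ hzt _ hzx
    have h1 : ‖nsRescale (l k) u (μ ^ 2 * t₁) (μ • y)‖ ≤ Mb' + ε₀ / (2 * μ) := by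
      have := norm_le_norm_sub_add (nsRescale (l k) u (μ ^ 2 * t₁) (μ • y)) (W (μ ^ 2 * t₁) (μ • y))
      rw [norm_sub_rev] at this
      linarith [hz.le]
    calc μ * ‖nsRescale (l k) u (μ ^ 2 * t₁) (μ • y)‖ ≤ μ * (Mb' + ε₀ / (2 * μ)) :=
          mul_le_mul_of_nonneg_left h1 hμpos.le
      _ = μ * Mb' + ε₀ / 2 := by field_simp
      _ ≤ ε₀ := by linarith
  -- ## ε-regularity bounds `v` near the origin ...
  have hbound := hER v hv hvL6 hvdata
  -- ## ... contradicting the scale invariance of the singularity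
  set r' : ℝ := min 1 (Real.sqrt s) with hr'
  have hr'pos : 0 < r' := lt_min one_pos (Real.sqrt_pos.2 hspos)
  have hr's : r' ^ 2 ≤ s := by
    have h1 : r' ≤ Real.sqrt s := min_le_right _ _
    have h2 : r' ^ 2 ≤ Real.sqrt s ^ 2 := pow_le_pow_left₀ hr'pos.le h1 2
    rwa [Real.sq_sqrt hspos.le] at h2
  obtain ⟨t, ht, x, hx, hbig⟩ := singularAtOrigin_nsRescale hsing hc r' hr'pos 1
  have ht' : t ∈ Ioo t₁ 0 := ⟨by rw [show t₁ = -s by rw [hs]; ring]; linarith [ht.1], ht.2⟩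
  have hx' : ‖x‖ < 2 := by
    rw [mem_ball_zero_iff] at hx
    linarith [min_le_left (1 : ℝ) (Real.sqrt s)]
  have := hbound t ht' x hx'
  rw [← hv_def] at hbig
  linarith

end RecurrentReductionD

/-- **`RecurrentReductionD` holds** (route `LerayQuarterDissipation`, thesis
`FiniteDissipationLiouville`, support item stmt-NavierStokesRegularity-22507): a Type-I mild
ancient solution with Leray's quarter dissipation law and a singularity at the origin has a
uniformly recurrent element of the same class, still singular at the origin, in the closure of
its scaling orbit (module docstring; Birkhoff recurrence + persistence of the singularity via the
pressure-free sup-norm ε-regularity of the class). NS regularity itself is not addressed.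
[cite: KochNadirashviliSereginSverak2009, §4–§6 (arXiv:0709.3599)] -/
theorem recurrentReductionD_proof :
    Summit.NavierStokesRegularity.NavierStokesRegularity.Theses.LerayQuarterDissipation.RecurrentReductionD := by
  intro C K u hu hlaw hsing
  obtain ⟨w, hw, hwlaw, hrec, hwsing⟩ :=
    RecurrentReductionD.exists_recurrent_of_persistent_unif hu hlaw
      (fun l hl W _ hunif _ => RecurrentReductionD.persistent_singularity hu hlaw hsing l hl W hunif)
  exact ⟨C, K, w, hw, hwlaw, hrec, hwsing⟩

end Summit.NavierStokesRegularity.NavierStokesRegularity.Theorems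

end
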